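import Summits.Ventures.PercRepro.C041ThreeExitMainA

/-!
# ROW C-041 — THEOREM (THREE-EXIT BLOCK MAP): the six-vector of a three-exit attachment is the sum over the
colourings of the multigraph of the contributions of the statuses of its three exits (p6, gen 31; mine-3's
C-041.md §20 (c) BLOCK MAPS with three exits, §21 (ah))

Setting of `C041ThreeExitSix`.  The fibre vector over a colouring is identified with `contrib3` of the statuses,
status pattern by status pattern (`fibVec3_eq_merged` for a merged first exit, `fibVec3_eq_sep` for a separated
one, through the fifteen counting lemmas), and

* **`sixVec_glue3`** (THEOREM (THREE-EXIT BLOCK MAP)): `Π(glue3 Z₁ u u' u'' Z a Z' a' Z'' a'') = ∑_ω contrib3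
  (Π Z) (Π Z') (Π Z'') (Mg a₁ u ω) (Rd a₁ u ω) (Mg a₁ u' ω) (Rd a₁ u' ω) (Mg a₁ u'' ω) (Rd a₁ u'' ω) (Mg u u' ω)
  (Mg u'' u' ω) (Mg u'' u ω)` — the six-vector of the attachment is an explicit trilinear function of the
  six-vectors of the three zones, indexed by the colourings of the multigraph.

The dictionary with mine-3's three-exit arc-type model `thetaSq` (the cycle host with three exits, the statuses
by the four arcs of `C041CycleStatus3`, the 81-case table) is `C041CycleDict3`.
-/

namespace PercRepro

namespace ZoneZ

namespace TwoExit

open ZoneData TreeClosure Finset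

variable {V₁ E₁ U₁ U₂ V E T₁ T₂ V' E' T₁' T₂' V'' E'' T₁'' T₂'' : Type}
variable (Z₁ : ZoneData V₁ E₁ U₁ U₂) (u u' u'' : V₁) (Z : ZoneData V E T₁ T₂) (a : V)
  (Z' : ZoneData V' E' T₁' T₂') (a' : V') (Z'' : ZoneData V'' E'' T₁'' T₂'') (a'' : V'') (a₁ : V₁)
variable [Fintype E₁] [DecidableEq E₁] [Fintype E] [DecidableEq E] [Fintype T₁] [DecidableEq T₁]
  [Fintype T₂] [DecidableEq T₂] [Fintype E'] [DecidableEq E'] [Fintype T₁'] [DecidableEq T₁']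
  [Fintype T₂'] [DecidableEq T₂'] [Fintype E''] [DecidableEq E''] [Fintype T₁''] [DecidableEq T₁'']
  [Fintype T₂''] [DecidableEq T₂'']

omit [Fintype E₁] [DecidableEq E₁] in
/-- The fibre vector is the contribution of the statuses: the first exit separated. -/
theorem fibVec3_eq_sep (ω : E₁ → Bool) (hm : ¬ Z₁.Mg a₁ u ω) :
    fibVec3 Z₁ u u' u'' Z a Z' a' Z'' a'' a₁ ω = contrib3 (Z.sixVec a) (Z'.sixVec a') (Z''.sixVec a'') (Z₁.Mg a₁ u ω) (Z₁.Rd a₁ u ω) (Z₁.Mg a₁ u' ω) (Z₁.Rd a₁ u' ω) (Z₁.Mg a₁ u'' ω) (Z₁.Rd a₁ u'' ω) (Z₁.Mg u u' ω) (Z₁.Mg u'' u' ω) (Z₁.Mg u'' u ω) := by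
  unfold contrib3
  rw [exitOf_sixVec, exitOf_sixVec, exitOf_sixVec]
  rw [if_neg hm]
  by_cases hm' : Z₁.Mg a₁ u' ω
  · rw [if_pos hm']
    by_cases hm'' : Z₁.Mg a₁ u'' ω
    · rw [if_pos hm'']
      simp only [thR_exitVec]
      refine vec6_ext _ _ ?_ ?_ ?_ ?_ ?_ ?_
      · simp only [fibVec3, exitVec, nVec, Pi.mul_apply, Matrix.cons_val]
        rw [card_fib3_s_mm Z₁ u u' u'' Z a Z' a' Z'' a'' a₁ ω hm hm' hm'' true true false (Or.inl rfl)]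
        push_cast
        ring
      · simp only [fibVec3, exitVec, nVec, Pi.mul_apply, Matrix.cons_val]
        rw [card_fib3_s_mm Z₁ u u' u'' Z a Z' a' Z'' a'' a₁ ω hm hm' hm'' false true false (Or.inr rfl)]
        push_cast
        ring
      · simp only [fibVec3, exitVec, nVec, Pi.mul_apply, Matrix.cons_val]
        rw [card_fib3_s_mm Z₁ u u' u'' Z a Z' a' Z'' a'' a₁ ω hm hm' hm'' true false false (Or.inl rfl)]
        push_cast
        ring
      · simp only [fibVec3, exitVec, nVec, Pi.mul_apply, Matrix.cons_val]
        rw [card_fib3_s_mm Z₁ u u' u'' Z a Z' a' Z'' a'' a₁ ω hm hm' hm'' true true true (Or.inl rfl)]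
        push_cast
        ring
      · simp only [fibVec3, exitVec, nVec, Pi.mul_apply, Matrix.cons_val]
        rw [card_fib3_s_mm Z₁ u u' u'' Z a Z' a' Z'' a'' a₁ ω hm hm' hm'' false true true (Or.inr rfl)]
        push_cast
        ring
      · simp only [fibVec3, exitVec, nVec, Pi.mul_apply, Matrix.cons_val]
        rw [card_fib3_s_mm Z₁ u u' u'' Z a Z' a' Z'' a'' a₁ ω hm hm' hm'' true false true (Or.inl rfl)]
        push_cast
        ring
    · rw [if_neg hm'']
      by_cases hbc'' : Z₁.Mg u'' u ω
      · rw [if_pos hbc'']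
        refine vec6_ext _ _ ?_ ?_ ?_ ?_ ?_ ?_
        · simp only [fibVec3, exitVec, thR, nAdm, kInv, Pi.mul_apply, Matrix.cons_val]
          have h := card_fib3_s_m_joint Z₁ u u' u'' Z a Z' a' Z'' a'' a₁ ω hm hm' hm'' hbc'' true true false
          have h' := congrArg (fun n : ℕ => (n : ℝ)) h
          push_cast at h'
          linear_combination h'
        · simp only [fibVec3, exitVec, thR, nAdm, kInv, Pi.mul_apply, Matrix.cons_val]
          have h := card_fib3_s_m_joint Z₁ u u' u'' Z a Z' a' Z'' a'' a₁ ω hm hm' hm'' hbc'' false true false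
          have h' := congrArg (fun n : ℕ => (n : ℝ)) h
          push_cast at h'
          linear_combination h'
        · simp only [fibVec3, exitVec, thR, nAdm, kInv, Pi.mul_apply, Matrix.cons_val]
          have h := card_fib3_s_m_joint Z₁ u u' u'' Z a Z' a' Z'' a'' a₁ ω hm hm' hm'' hbc'' true false false
          have h' := congrArg (fun n : ℕ => (n : ℝ)) h
          push_cast at h'
          linear_combination h'
        · simp only [fibVec3, exitVec, thR, nAdm, kInv, Pi.mul_apply, Matrix.cons_val]
          have h := card_fib3_s_m_joint Z₁ u u' u'' Z a Z' a' Z'' a'' a₁ ω hm hm' hm'' hbc'' true true true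
          have h' := congrArg (fun n : ℕ => (n : ℝ)) h
          push_cast at h'
          linear_combination h'
        · simp only [fibVec3, exitVec, thR, nAdm, kInv, Pi.mul_apply, Matrix.cons_val]
          have h := card_fib3_s_m_joint Z₁ u u' u'' Z a Z' a' Z'' a'' a₁ ω hm hm' hm'' hbc'' false true true
          have h' := congrArg (fun n : ℕ => (n : ℝ)) h
          push_cast at h'
          linear_combination h'
        · simp only [fibVec3, exitVec, thR, nAdm, kInv, Pi.mul_apply, Matrix.cons_val]
          have h := card_fib3_s_m_joint Z₁ u u' u'' Z a Z' a' Z'' a'' a₁ ω hm hm' hm'' hbc'' true false true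
          have h' := congrArg (fun n : ℕ => (n : ℝ)) h
          push_cast at h'
          linear_combination h'
      · rw [if_neg hbc'']
        simp only [thR_exitVec]
        refine vec6_ext _ _ ?_ ?_ ?_ ?_ ?_ ?_
        · simp only [fibVec3, exitVec, nVec, Pi.mul_apply, Matrix.cons_val]
          rw [card_fib3_s_m_s Z₁ u u' u'' Z a Z' a' Z'' a'' a₁ ω hm hm' hm'' hbc'' true true false]
          push_cast
          ring
        · simp only [fibVec3, exitVec, nVec, Pi.mul_apply, Matrix.cons_val]
          rw [card_fib3_s_m_s Z₁ u u' u'' Z a Z' a' Z'' a'' a₁ ω hm hm' hm'' hbc'' false true false]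
          push_cast
          ring
        · simp only [fibVec3, exitVec, nVec, Pi.mul_apply, Matrix.cons_val]
          rw [card_fib3_s_m_s Z₁ u u' u'' Z a Z' a' Z'' a'' a₁ ω hm hm' hm'' hbc'' true false false]
          push_cast
          ring
        · simp only [fibVec3, exitVec, nVec, Pi.mul_apply, Matrix.cons_val]
          rw [card_fib3_s_m_s Z₁ u u' u'' Z a Z' a' Z'' a'' a₁ ω hm hm' hm'' hbc'' true true true]
          push_cast
          ring
        · simp only [fibVec3, exitVec, nVec, Pi.mul_apply, Matrix.cons_val]
          rw [card_fib3_s_m_s Z₁ u u' u'' Z a Z' a' Z'' a'' a₁ ω hm hm' hm'' hbc'' false true true]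
          push_cast
          ring
        · simp only [fibVec3, exitVec, nVec, Pi.mul_apply, Matrix.cons_val]
          rw [card_fib3_s_m_s Z₁ u u' u'' Z a Z' a' Z'' a'' a₁ ω hm hm' hm'' hbc'' true false true]
          push_cast
          ring
  · rw [if_neg hm']
    by_cases hm'' : Z₁.Mg a₁ u'' ω
    · rw [if_pos hm'']
      by_cases hbc : Z₁.Mg u u' ω
      · rw [if_pos hbc]
        refine vec6_ext _ _ ?_ ?_ ?_ ?_ ?_ ?_
        · simp only [fibVec3, exitVec, thR, nAdm, kInv, Pi.mul_apply, Matrix.cons_val]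
          have h := card_fib3_s_s_m_joint Z₁ u u' u'' Z a Z' a' Z'' a'' a₁ ω hm hm' hm'' hbc true true false
          have h' := congrArg (fun n : ℕ => (n : ℝ)) h
          push_cast at h'
          linear_combination h'
        · simp only [fibVec3, exitVec, thR, nAdm, kInv, Pi.mul_apply, Matrix.cons_val]
          have h := card_fib3_s_s_m_joint Z₁ u u' u'' Z a Z' a' Z'' a'' a₁ ω hm hm' hm'' hbc false true false
          have h' := congrArg (fun n : ℕ => (n : ℝ)) h
          push_cast at h'
          linear_combination h'
        · simp only [fibVec3, exitVec, thR, nAdm, kInv, Pi.mul_apply, Matrix.cons_val]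
          have h := card_fib3_s_s_m_joint Z₁ u u' u'' Z a Z' a' Z'' a'' a₁ ω hm hm' hm'' hbc true false false
          have h' := congrArg (fun n : ℕ => (n : ℝ)) h
          push_cast at h'
          linear_combination h'
        · simp only [fibVec3, exitVec, thR, nAdm, kInv, Pi.mul_apply, Matrix.cons_val]
          have h := card_fib3_s_s_m_joint Z₁ u u' u'' Z a Z' a' Z'' a'' a₁ ω hm hm' hm'' hbc true true true
          have h' := congrArg (fun n : ℕ => (n : ℝ)) h
          push_cast at h'
          linear_combination h'
        · simp only [fibVec3, exitVec, thR, nAdm, kInv, Pi.mul_apply, Matrix.cons_val]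
          have h := card_fib3_s_s_m_joint Z₁ u u' u'' Z a Z' a' Z'' a'' a₁ ω hm hm' hm'' hbc false true true
          have h' := congrArg (fun n : ℕ => (n : ℝ)) h
          push_cast at h'
          linear_combination h'
        · simp only [fibVec3, exitVec, thR, nAdm, kInv, Pi.mul_apply, Matrix.cons_val]
          have h := card_fib3_s_s_m_joint Z₁ u u' u'' Z a Z' a' Z'' a'' a₁ ω hm hm' hm'' hbc true false true
          have h' := congrArg (fun n : ℕ => (n : ℝ)) h
          push_cast at h'
          linear_combination h'
      · rw [if_neg hbc]
        simp only [thR_exitVec]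
        refine vec6_ext _ _ ?_ ?_ ?_ ?_ ?_ ?_
        · simp only [fibVec3, exitVec, nVec, Pi.mul_apply, Matrix.cons_val]
          rw [card_fib3_s_s_m Z₁ u u' u'' Z a Z' a' Z'' a'' a₁ ω hm hm' hm'' hbc true true false]
          push_cast
          ring
        · simp only [fibVec3, exitVec, nVec, Pi.mul_apply, Matrix.cons_val]
          rw [card_fib3_s_s_m Z₁ u u' u'' Z a Z' a' Z'' a'' a₁ ω hm hm' hm'' hbc false true false]
          push_cast
          ring
        · simp only [fibVec3, exitVec, nVec, Pi.mul_apply, Matrix.cons_val]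
          rw [card_fib3_s_s_m Z₁ u u' u'' Z a Z' a' Z'' a'' a₁ ω hm hm' hm'' hbc true false false]
          push_cast
          ring
        · simp only [fibVec3, exitVec, nVec, Pi.mul_apply, Matrix.cons_val]
          rw [card_fib3_s_s_m Z₁ u u' u'' Z a Z' a' Z'' a'' a₁ ω hm hm' hm'' hbc true true true]
          push_cast
          ring
        · simp only [fibVec3, exitVec, nVec, Pi.mul_apply, Matrix.cons_val]
          rw [card_fib3_s_s_m Z₁ u u' u'' Z a Z' a' Z'' a'' a₁ ω hm hm' hm'' hbc false true true]
          push_cast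
          ring
        · simp only [fibVec3, exitVec, nVec, Pi.mul_apply, Matrix.cons_val]
          rw [card_fib3_s_s_m Z₁ u u' u'' Z a Z' a' Z'' a'' a₁ ω hm hm' hm'' hbc true false true]
          push_cast
          ring
    · rw [if_neg hm'']
      by_cases hbc : Z₁.Mg u u' ω
      · rw [if_pos hbc]
        by_cases hbc' : Z₁.Mg u'' u' ω
        · rw [if_pos hbc']
          refine vec6_ext _ _ ?_ ?_ ?_ ?_ ?_ ?_
          · simp only [fibVec3, exitVec, thR, nAdm, kInv, Pi.mul_apply, Matrix.cons_val]
            have h := card_fib3_joint3 Z₁ u u' u'' Z a Z' a' Z'' a'' a₁ ω hm hm' hm'' hbc hbc' true true false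
            have h' := congrArg (fun n : ℕ => (n : ℝ)) h
            push_cast at h'
            linear_combination h'
          · simp only [fibVec3, exitVec, thR, nAdm, kInv, Pi.mul_apply, Matrix.cons_val]
            have h := card_fib3_joint3 Z₁ u u' u'' Z a Z' a' Z'' a'' a₁ ω hm hm' hm'' hbc hbc' false true false
            have h' := congrArg (fun n : ℕ => (n : ℝ)) h
            push_cast at h'
            linear_combination h'
          · simp only [fibVec3, exitVec, thR, nAdm, kInv, Pi.mul_apply, Matrix.cons_val]
            have h := card_fib3_joint3 Z₁ u u' u'' Z a Z' a' Z'' a'' a₁ ω hm hm' hm'' hbc hbc' true false false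
            have h' := congrArg (fun n : ℕ => (n : ℝ)) h
            push_cast at h'
            linear_combination h'
          · simp only [fibVec3, exitVec, thR, nAdm, kInv, Pi.mul_apply, Matrix.cons_val]
            have h := card_fib3_joint3 Z₁ u u' u'' Z a Z' a' Z'' a'' a₁ ω hm hm' hm'' hbc hbc' true true true
            have h' := congrArg (fun n : ℕ => (n : ℝ)) h
            push_cast at h'
            linear_combination h'
          · simp only [fibVec3, exitVec, thR, nAdm, kInv, Pi.mul_apply, Matrix.cons_val]
            have h := card_fib3_joint3 Z₁ u u' u'' Z a Z' a' Z'' a'' a₁ ω hm hm' hm'' hbc hbc' false true true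
            have h' := congrArg (fun n : ℕ => (n : ℝ)) h
            push_cast at h'
            linear_combination h'
          · simp only [fibVec3, exitVec, thR, nAdm, kInv, Pi.mul_apply, Matrix.cons_val]
            have h := card_fib3_joint3 Z₁ u u' u'' Z a Z' a' Z'' a'' a₁ ω hm hm' hm'' hbc hbc' true false true
            have h' := congrArg (fun n : ℕ => (n : ℝ)) h
            push_cast at h'
            linear_combination h'
        · rw [if_neg hbc']
          have hbc'' : ¬ Z₁.Mg u'' u ω := fun h => hbc' (Mg_trans Z₁ ω u'' u u' h hbc)
          simp only [thR_exitVec]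
          refine vec6_ext _ _ ?_ ?_ ?_ ?_ ?_ ?_
          · simp only [fibVec3, exitVec, nVec, thR, nAdm, kInv, Pi.mul_apply, Matrix.cons_val]
            have h := card_fib3_joint12 Z₁ u u' u'' Z a Z' a' Z'' a'' a₁ ω hm hm' hm'' hbc hbc' hbc'' true true false
            have h' := congrArg (fun n : ℕ => (n : ℝ)) h
            push_cast at h'
            linear_combination h'
          · simp only [fibVec3, exitVec, nVec, thR, nAdm, kInv, Pi.mul_apply, Matrix.cons_val]
            have h := card_fib3_joint12 Z₁ u u' u'' Z a Z' a' Z'' a'' a₁ ω hm hm' hm'' hbc hbc' hbc'' false true false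
            have h' := congrArg (fun n : ℕ => (n : ℝ)) h
            push_cast at h'
            linear_combination h'
          · simp only [fibVec3, exitVec, nVec, thR, nAdm, kInv, Pi.mul_apply, Matrix.cons_val]
            have h := card_fib3_joint12 Z₁ u u' u'' Z a Z' a' Z'' a'' a₁ ω hm hm' hm'' hbc hbc' hbc'' true false false
            have h' := congrArg (fun n : ℕ => (n : ℝ)) h
            push_cast at h'
            linear_combination h'
          · simp only [fibVec3, exitVec, nVec, thR, nAdm, kInv, Pi.mul_apply, Matrix.cons_val]
            have h := card_fib3_joint12 Z₁ u u' u'' Z a Z' a' Z'' a'' a₁ ω hm hm' hm'' hbc hbc' hbc'' true true true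
            have h' := congrArg (fun n : ℕ => (n : ℝ)) h
            push_cast at h'
            linear_combination h'
          · simp only [fibVec3, exitVec, nVec, thR, nAdm, kInv, Pi.mul_apply, Matrix.cons_val]
            have h := card_fib3_joint12 Z₁ u u' u'' Z a Z' a' Z'' a'' a₁ ω hm hm' hm'' hbc hbc' hbc'' false true true
            have h' := congrArg (fun n : ℕ => (n : ℝ)) h
            push_cast at h'
            linear_combination h'
          · simp only [fibVec3, exitVec, nVec, thR, nAdm, kInv, Pi.mul_apply, Matrix.cons_val]
            have h := card_fib3_joint12 Z₁ u u' u'' Z a Z' a' Z'' a'' a₁ ω hm hm' hm'' hbc hbc' hbc'' true false true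
            have h' := congrArg (fun n : ℕ => (n : ℝ)) h
            push_cast at h'
            linear_combination h'
      · rw [if_neg hbc]
        by_cases hbc'' : Z₁.Mg u'' u ω
        · rw [if_pos hbc'']
          have hbc' : ¬ Z₁.Mg u'' u' ω := fun h => hbc (Mg_trans Z₁ ω u u'' u' (Mg_symm Z₁ ω u'' u hbc'') h)
          simp only [thR_exitVec]
          refine vec6_ext _ _ ?_ ?_ ?_ ?_ ?_ ?_
          · simp only [fibVec3, exitVec, nVec, thR, nAdm, kInv, Pi.mul_apply, Matrix.cons_val]
            have h := card_fib3_joint13 Z₁ u u' u'' Z a Z' a' Z'' a'' a₁ ω hm hm' hm'' hbc hbc' hbc'' true true false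
            have h' := congrArg (fun n : ℕ => (n : ℝ)) h
            push_cast at h'
            linear_combination h'
          · simp only [fibVec3, exitVec, nVec, thR, nAdm, kInv, Pi.mul_apply, Matrix.cons_val]
            have h := card_fib3_joint13 Z₁ u u' u'' Z a Z' a' Z'' a'' a₁ ω hm hm' hm'' hbc hbc' hbc'' false true false
            have h' := congrArg (fun n : ℕ => (n : ℝ)) h
            push_cast at h'
            linear_combination h'
          · simp only [fibVec3, exitVec, nVec, thR, nAdm, kInv, Pi.mul_apply, Matrix.cons_val]
            have h := card_fib3_joint13 Z₁ u u' u'' Z a Z' a' Z'' a'' a₁ ω hm hm' hm'' hbc hbc' hbc'' true false false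
            have h' := congrArg (fun n : ℕ => (n : ℝ)) h
            push_cast at h'
            linear_combination h'
          · simp only [fibVec3, exitVec, nVec, thR, nAdm, kInv, Pi.mul_apply, Matrix.cons_val]
            have h := card_fib3_joint13 Z₁ u u' u'' Z a Z' a' Z'' a'' a₁ ω hm hm' hm'' hbc hbc' hbc'' true true true
            have h' := congrArg (fun n : ℕ => (n : ℝ)) h
            push_cast at h'
            linear_combination h'
          · simp only [fibVec3, exitVec, nVec, thR, nAdm, kInv, Pi.mul_apply, Matrix.cons_val]
            have h := card_fib3_joint13 Z₁ u u' u'' Z a Z' a' Z'' a'' a₁ ω hm hm' hm'' hbc hbc' hbc'' false true true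
            have h' := congrArg (fun n : ℕ => (n : ℝ)) h
            push_cast at h'
            linear_combination h'
          · simp only [fibVec3, exitVec, nVec, thR, nAdm, kInv, Pi.mul_apply, Matrix.cons_val]
            have h := card_fib3_joint13 Z₁ u u' u'' Z a Z' a' Z'' a'' a₁ ω hm hm' hm'' hbc hbc' hbc'' true false true
            have h' := congrArg (fun n : ℕ => (n : ℝ)) h
            push_cast at h'
            linear_combination h'
        · rw [if_neg hbc'']
          by_cases hbc' : Z₁.Mg u'' u' ω
          · rw [if_pos hbc']
            simp only [thR_exitVec]
            refine vec6_ext _ _ ?_ ?_ ?_ ?_ ?_ ?_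
            · simp only [fibVec3, exitVec, nVec, thR, nAdm, kInv, Pi.mul_apply, Matrix.cons_val]
              have h := card_fib3_joint23 Z₁ u u' u'' Z a Z' a' Z'' a'' a₁ ω hm hm' hm'' hbc hbc' hbc'' true true false
              have h' := congrArg (fun n : ℕ => (n : ℝ)) h
              push_cast at h'
              linear_combination h'
            · simp only [fibVec3, exitVec, nVec, thR, nAdm, kInv, Pi.mul_apply, Matrix.cons_val]
              have h := card_fib3_joint23 Z₁ u u' u'' Z a Z' a' Z'' a'' a₁ ω hm hm' hm'' hbc hbc' hbc'' false true false
              have h' := congrArg (fun n : ℕ => (n : ℝ)) h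
              push_cast at h'
              linear_combination h'
            · simp only [fibVec3, exitVec, nVec, thR, nAdm, kInv, Pi.mul_apply, Matrix.cons_val]
              have h := card_fib3_joint23 Z₁ u u' u'' Z a Z' a' Z'' a'' a₁ ω hm hm' hm'' hbc hbc' hbc'' true false false
              have h' := congrArg (fun n : ℕ => (n : ℝ)) h
              push_cast at h'
              linear_combination h'
            · simp only [fibVec3, exitVec, nVec, thR, nAdm, kInv, Pi.mul_apply, Matrix.cons_val]
              have h := card_fib3_joint23 Z₁ u u' u'' Z a Z' a' Z'' a'' a₁ ω hm hm' hm'' hbc hbc' hbc'' true true true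
              have h' := congrArg (fun n : ℕ => (n : ℝ)) h
              push_cast at h'
              linear_combination h'
            · simp only [fibVec3, exitVec, nVec, thR, nAdm, kInv, Pi.mul_apply, Matrix.cons_val]
              have h := card_fib3_joint23 Z₁ u u' u'' Z a Z' a' Z'' a'' a₁ ω hm hm' hm'' hbc hbc' hbc'' false true true
              have h' := congrArg (fun n : ℕ => (n : ℝ)) h
              push_cast at h'
              linear_combination h'
            · simp only [fibVec3, exitVec, nVec, thR, nAdm, kInv, Pi.mul_apply, Matrix.cons_val]
              have h := card_fib3_joint23 Z₁ u u' u'' Z a Z' a' Z'' a'' a₁ ω hm hm' hm'' hbc hbc' hbc'' true false true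
              have h' := congrArg (fun n : ℕ => (n : ℝ)) h
              push_cast at h'
              linear_combination h'
          · rw [if_neg hbc']
            simp only [thR_exitVec]
            refine vec6_ext _ _ ?_ ?_ ?_ ?_ ?_ ?_
            · simp only [fibVec3, nVec, Pi.mul_apply, Matrix.cons_val]
              rw [card_fib3_sss Z₁ u u' u'' Z a Z' a' Z'' a'' a₁ ω hm hm' hm'' hbc hbc' hbc'' true true false]
              push_cast
              ring
            · simp only [fibVec3, nVec, Pi.mul_apply, Matrix.cons_val]
              rw [card_fib3_sss Z₁ u u' u'' Z a Z' a' Z'' a'' a₁ ω hm hm' hm'' hbc hbc' hbc'' false true false]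
              push_cast
              ring
            · simp only [fibVec3, nVec, Pi.mul_apply, Matrix.cons_val]
              rw [card_fib3_sss Z₁ u u' u'' Z a Z' a' Z'' a'' a₁ ω hm hm' hm'' hbc hbc' hbc'' true false false]
              push_cast
              ring
            · simp only [fibVec3, nVec, Pi.mul_apply, Matrix.cons_val]
              rw [card_fib3_sss Z₁ u u' u'' Z a Z' a' Z'' a'' a₁ ω hm hm' hm'' hbc hbc' hbc'' true true true]
              push_cast
              ring
            · simp only [fibVec3, nVec, Pi.mul_apply, Matrix.cons_val]
              rw [card_fib3_sss Z₁ u u' u'' Z a Z' a' Z'' a'' a₁ ω hm hm' hm'' hbc hbc' hbc'' false true true]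
              push_cast
              ring
            · simp only [fibVec3, nVec, Pi.mul_apply, Matrix.cons_val]
              rw [card_fib3_sss Z₁ u u' u'' Z a Z' a' Z'' a'' a₁ ω hm hm' hm'' hbc hbc' hbc'' true false true]
              push_cast
              ring

omit [Fintype E₁] [DecidableEq E₁] in
/-- **The fibre vector is the contribution of the statuses.** -/
theorem fibVec3_eq (ω : E₁ → Bool) :
    fibVec3 Z₁ u u' u'' Z a Z' a' Z'' a'' a₁ ω = contrib3 (Z.sixVec a) (Z'.sixVec a') (Z''.sixVec a'') (Z₁.Mg a₁ u ω) (Z₁.Rd a₁ u ω) (Z₁.Mg a₁ u' ω) (Z₁.Rd a₁ u' ω) (Z₁.Mg a₁ u'' ω) (Z₁.Rd a₁ u'' ω) (Z₁.Mg u u' ω) (Z₁.Mg u'' u' ω) (Z₁.Mg u'' u ω) := by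
  by_cases hm : Z₁.Mg a₁ u ω
  · exact fibVec3_eq_merged Z₁ u u' u'' Z a Z' a' Z'' a'' a₁ ω hm
  · exact fibVec3_eq_sep Z₁ u u' u'' Z a Z' a' Z'' a'' a₁ ω hm

/-- **THEOREM (THREE-EXIT BLOCK MAP)**: the six-vector of the three-exit attachment, at the anchor `a₁` of the
multigraph, is the sum over the colourings `ω` of `Z₁` of the contribution of the statuses of the three exits. -/
theorem sixVec_glue3 :
    (glue3 Z₁ u u' u'' Z a Z' a' Z'' a'').sixVec (Sum.inl (Sum.inl (Sum.inl a₁))) =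
      ∑ ω : E₁ → Bool, contrib3 (Z.sixVec a) (Z'.sixVec a') (Z''.sixVec a'') (Z₁.Mg a₁ u ω) (Z₁.Rd a₁ u ω) (Z₁.Mg a₁ u' ω) (Z₁.Rd a₁ u' ω) (Z₁.Mg a₁ u'' ω) (Z₁.Rd a₁ u'' ω) (Z₁.Mg u u' ω) (Z₁.Mg u'' u' ω) (Z₁.Mg u'' u ω) := by
  rw [sixVec_eq_sum_fibVec3]
  exact Finset.sum_congr rfl fun ω _ => fibVec3_eq Z₁ u u' u'' Z a Z' a' Z'' a'' a₁ ω

end TwoExit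

end ZoneZ

end PercRepro
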